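import Summits.QuantumFields.QCD.Theorems.HeatSlicedQuarksQuarkLoopCoefficientFreeMajorantToolkitAux

/-!
# Quark-loop coefficient, stub `freeMajorantToolkit`, part B: mass, moments, shifts, image sum

Four conjuncts of the profile calculus of the two-regime Gaussian majorant
`Γ_c(t, w) = (1+t)⁻² exp(−c|w|²/(1 + t + |w|))` (`gaussProfile`) used by the line `Sketch` of the
crux `QuarkLoopCoefficient`:

* (5) mass: `Σ_y Γ_c(t, y) ≤ A_c` uniformly in `t ≥ 0` (the exponent dominates the linear function
  `r/(2√(1+t)) − 1/2`, so the profile is dominated by a product of two-sided geometric profiles of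
  slope `c/(8√(1+t))`, whose mass `(2 + 16√(1+t)/c)⁴ ≤ (1+t)² (2 + 16/c)⁴` cancels the prefactor);
* (3) moments: `|w|ʲ Γ_c(t, w) ≤ A √(1+t)ʲ Γ_{(1−ε)c}(t, w)` (Gaussian moments `xʲ ≤ j! eˣ`);
* (4) shifts: `Γ_c(t, w + z) ≤ e^{2c} Γ_{(1−ε)c}(t, w)` for `|z| ≤ 2` (the exponent is `1`-Lipschitz);
* (6) image sum: for `1 ≤ t ≤ L²`, `Σ_{n ≠ 0} Γ_c(t, L•n) ≤ C e^{−(c/2)L²/(t+L)}/t²` (for `|n| ≥ 1`,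
  `(L|n|)²/(1+t+L|n|) ≥ |n| L²/(1+t+L) ≥ L²/(2(t+L)) + (|n| − 1)/3`).

Mathlib only, on top of part A (`…FreeMajorantToolkitAux`).
-/

namespace Summit.QuantumFields.QCD.Cruxes.QuarkLoopCoefficient.Sketch.FreeMajorantToolkit

open Summit.QuantumFields.QCD.Theorems.QuarkLoopCoefficient
open Literature.MathematicalPhysics.QuantumLattice Literature.MathematicalPhysics.QuantumFieldTheory
open Literature.Probability.LatticeModels (Site TorusSite)
open scoped Matrix ComplexConjugate

/-! ### (5) Mass -/

/-- Pointwise domination of the profile by a product of two-sided geometric profiles: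
`Γ_c(t, y) ≤ (1+t)⁻² e^{c/2} exp(−(c/(8√(1+t))) Σ_μ |y_μ|)`. -/
theorem gaussProfile_le_exp_sum_abs {c t : ℝ} (hc : 0 < c) (ht : 0 ≤ t) (y : Site 4) :
    gaussProfile c t y ≤ ((1 + t) ^ 2)⁻¹ * Real.exp (c / 2) *
      Real.exp (-(c / (8 * Real.sqrt (1 + t)) * ∑ μ : Fin 4, |((y μ : ℤ) : ℝ)|)) := by
  unfold gaussProfile
  rw [mul_assoc, ← Real.exp_add]
  have hK1 : (1 : ℝ) ≤ 1 + t := by linarith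
  have hs1 : 1 ≤ Real.sqrt (1 + t) := Real.one_le_sqrt.mpr hK1
  have hs0 : 0 < Real.sqrt (1 + t) := by linarith
  have hr := elen_nonneg y
  have hlin := linear_le_sq_div_add hK1 hr
  have hl1 := sum_abs_le_four_mul_elen y
  have h1 : c / (8 * Real.sqrt (1 + t)) * ∑ μ : Fin 4, |((y μ : ℤ) : ℝ)| ≤
      c * (elen y / (2 * Real.sqrt (1 + t))) := by
    calc c / (8 * Real.sqrt (1 + t)) * ∑ μ : Fin 4, |((y μ : ℤ) : ℝ)|
        ≤ c / (8 * Real.sqrt (1 + t)) * (4 * elen y) := by gcongr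
      _ = c * (elen y / (2 * Real.sqrt (1 + t))) := by field_simp; ring
  have h2 : c * (elen y / (2 * Real.sqrt (1 + t)) - 1 / 2) ≤ c * (elen y ^ 2 / (1 + t + elen y)) :=
    mul_le_mul_of_nonneg_left hlin hc.le
  have h3 : c * (elen y ^ 2 / (1 + t + elen y)) = c * elen y ^ 2 / (1 + t + elen y) := by ring
  gcongr
  linarith

/-- Conjunct (5), quantitative: the mass of the profile is at most `e^{c/2} (2 + 16/c)⁴`,
uniformly in `t ≥ 0`. -/
theorem mass_bound {c : ℝ} (hc : 0 < c) {t : ℝ} (ht : 0 ≤ t) :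
    Summable (fun y : Site 4 => gaussProfile c t y) ∧
      ∑' y : Site 4, gaussProfile c t y ≤ Real.exp (c / 2) * (2 + 16 / c) ^ 4 := by
  set s := Real.sqrt (1 + t) with hs
  have hK1 : (1 : ℝ) ≤ 1 + t := by linarith
  have hs1 : 1 ≤ s := Real.one_le_sqrt.mpr hK1
  have hs0 : 0 < s := by linarith
  have hss : s ^ 2 = 1 + t := Real.sq_sqrt (by linarith)
  have hβ : 0 < c / (8 * s) := by positivity
  obtain ⟨hsum, hle⟩ := summable_site_of_le_exp_sum_abs hβ (by positivity)
    (fun y => gaussProfile_nonneg c t y) (fun y => gaussProfile_le_exp_sum_abs hc ht y)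
  refine ⟨hsum, hle.trans ?_⟩
  have e1 : 2 + 2 / (c / (8 * s)) = 2 + 16 * s / c := by field_simp; ring
  have h1 : 2 + 16 * s / c ≤ s * (2 + 16 / c) := by
    have e : s * (2 + 16 / c) = 2 * s + 16 * s / c := by ring
    rw [e]
    linarith
  have h0 : 0 ≤ 2 + 16 * s / c := by positivity
  have h4 : (2 + 16 * s / c) ^ 4 ≤ (1 + t) ^ 2 * (2 + 16 / c) ^ 4 := by
    calc (2 + 16 * s / c) ^ 4 ≤ (s * (2 + 16 / c)) ^ 4 := by gcongr
      _ = (s ^ 2) ^ 2 * (2 + 16 / c) ^ 4 := by ring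
      _ = (1 + t) ^ 2 * (2 + 16 / c) ^ 4 := by rw [hss]
  rw [e1]
  have hKpos : 0 < (1 + t) ^ 2 := by positivity
  calc ((1 + t) ^ 2)⁻¹ * Real.exp (c / 2) * (2 + 16 * s / c) ^ 4
      ≤ ((1 + t) ^ 2)⁻¹ * Real.exp (c / 2) * ((1 + t) ^ 2 * (2 + 16 / c) ^ 4) := by gcongr
    _ = Real.exp (c / 2) * (2 + 16 / c) ^ 4 := by field_simp

/-! ### (3) Moments -/

/-- The Gaussian moment bound: `rʲ e^{−κ r²/(K+r)} ≤ e^{κ/2} j! (2/κ)ʲ √Kʲ` (`κ > 0`, `K ≥ 1`,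
`r ≥ 0`). -/
theorem pow_mul_exp_neg_le {κ K r : ℝ} (hκ : 0 < κ) (hK : 1 ≤ K) (hr : 0 ≤ r) (j : ℕ) :
    r ^ j * Real.exp (-(κ * (r ^ 2 / (K + r)))) ≤
      Real.exp (κ / 2) * (j.factorial * (2 / κ) ^ j) * Real.sqrt K ^ j := by
  set s := Real.sqrt K with hs
  have hs1 : 1 ≤ s := Real.one_le_sqrt.mpr hK
  have hs0 : 0 < s := by linarith
  have hlin := linear_le_sq_div_add hK hr
  set x := κ * r / (2 * s) with hx
  have hx0 : 0 ≤ x := by positivity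
  have hexp : Real.exp (-(κ * (r ^ 2 / (K + r)))) ≤ Real.exp (κ / 2) * Real.exp (-x) := by
    rw [← Real.exp_add]
    apply Real.exp_le_exp.2
    have h := mul_le_mul_of_nonneg_left hlin hκ.le
    have e : κ * (r / (2 * s) - 1 / 2) = κ * r / (2 * s) - κ / 2 := by ring
    rw [hx]
    linarith
  have hpow : x ^ j ≤ j.factorial * Real.exp x := by
    have h := Real.pow_div_factorial_le_exp x hx0 j
    rwa [div_le_iff₀ (by positivity), mul_comm] at h
  have hr_eq : r = 2 * s / κ * x := by
    rw [hx]; field_simp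
  calc r ^ j * Real.exp (-(κ * (r ^ 2 / (K + r))))
      ≤ r ^ j * (Real.exp (κ / 2) * Real.exp (-x)) := by gcongr
    _ = (2 * s / κ) ^ j * Real.exp (κ / 2) * (x ^ j * Real.exp (-x)) := by
        rw [hr_eq]; ring
    _ ≤ (2 * s / κ) ^ j * Real.exp (κ / 2) * (j.factorial * Real.exp x * Real.exp (-x)) := by
        gcongr
    _ = Real.exp (κ / 2) * (j.factorial * (2 / κ) ^ j) * s ^ j := by
        rw [mul_assoc (j.factorial : ℝ), ← Real.exp_add, add_neg_cancel, Real.exp_zero]; ring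

/-- Conjunct (3), quantitative: `|w|ʲ Γ_c(t, w) ≤ e^{εc/2} j! (2/(εc))ʲ · √(1+t)ʲ · Γ_{(1−ε)c}(t, w)`. -/
theorem moment_bound {c ε : ℝ} (hc : 0 < c) (hε : 0 < ε) (j : ℕ) {t : ℝ} (ht : 0 ≤ t)
    (w : Site 4) :
    elen w ^ j * gaussProfile c t w ≤
      (Real.exp (ε * c / 2) * (j.factorial * (2 / (ε * c)) ^ j)) * Real.sqrt (1 + t) ^ j *
        gaussProfile ((1 - ε) * c) t w := by
  have hκ : 0 < ε * c := mul_pos hε hc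
  have hK : (1 : ℝ) ≤ 1 + t := by linarith
  have hr := elen_nonneg w
  have key := pow_mul_exp_neg_le hκ hK hr j
  unfold gaussProfile
  have split : Real.exp (-(c * elen w ^ 2 / (1 + t + elen w))) =
      Real.exp (-(ε * c * (elen w ^ 2 / (1 + t + elen w)))) *
        Real.exp (-((1 - ε) * c * elen w ^ 2 / (1 + t + elen w))) := by
    rw [← Real.exp_add]; congr 1; ring
  rw [split]
  calc elen w ^ j * (((1 + t) ^ 2)⁻¹ * (Real.exp (-(ε * c * (elen w ^ 2 / (1 + t + elen w)))) *
        Real.exp (-((1 - ε) * c * elen w ^ 2 / (1 + t + elen w)))))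
      = (elen w ^ j * Real.exp (-(ε * c * (elen w ^ 2 / (1 + t + elen w))))) *
          (((1 + t) ^ 2)⁻¹ * Real.exp (-((1 - ε) * c * elen w ^ 2 / (1 + t + elen w)))) := by
        ring
    _ ≤ (Real.exp (ε * c / 2) * (j.factorial * (2 / (ε * c)) ^ j) * Real.sqrt (1 + t) ^ j) *
          (((1 + t) ^ 2)⁻¹ * Real.exp (-((1 - ε) * c * elen w ^ 2 / (1 + t + elen w)))) := by
        gcongr
    _ = _ := by ring

/-! ### (4) Shifts -/

/-- Conjunct (4), quantitative: `Γ_c(t, w + z) ≤ e^{2c} Γ_{(1−ε)c}(t, w)` for `|z| ≤ 2`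
(`0 ≤ ε`). -/
theorem shift_bound {c ε : ℝ} (hc : 0 < c) (hε : 0 ≤ ε) {t : ℝ} (ht : 0 ≤ t) (w z : Site 4)
    (hz : elen z ≤ 2) :
    gaussProfile c t (w + z) ≤ Real.exp (2 * c) * gaussProfile ((1 - ε) * c) t w := by
  unfold gaussProfile
  have hr : 0 ≤ elen w := elen_nonneg w
  have hr' : 0 ≤ elen (w + z) := elen_nonneg (w + z)
  have hK : (0 : ℝ) < 1 + t := by linarith
  have h1 : elen (w + z) ≤ elen w + elen z := elen_add_le w z
  have h2 : elen w ≤ elen (w + z) + elen z := elen_le_elen_add_add w z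
  have habs : |elen w - elen (w + z)| ≤ 2 := by
    rw [abs_le]; constructor <;> linarith
  have hlip := sq_div_add_sub_le hK hr hr'
  have hf0 : 0 ≤ elen w ^ 2 / (1 + t + elen w) := by positivity
  rw [mul_left_comm, ← Real.exp_add]
  gcongr
  have e1 : c * elen (w + z) ^ 2 / (1 + t + elen (w + z)) =
      c * (elen (w + z) ^ 2 / (1 + t + elen (w + z))) := by ring
  have e2 : (1 - ε) * c * elen w ^ 2 / (1 + t + elen w) =
      c * (elen w ^ 2 / (1 + t + elen w)) - ε * c * (elen w ^ 2 / (1 + t + elen w)) := by ring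
  rw [e1, e2]
  have h3 : c * (elen w ^ 2 / (1 + t + elen w)) - c * (elen (w + z) ^ 2 / (1 + t + elen (w + z)))
      ≤ 2 * c := by
    rw [← mul_sub]; nlinarith
  have h4 : 0 ≤ ε * c * (elen w ^ 2 / (1 + t + elen w)) := by positivity
  linarith

/-! ### (6) Image sum -/

/-- The image-sum exponent: `m · L²/(K + L) ≤ (L m)²/(K + L m)` for `m ≥ 1`, `K, L > 0`. -/
theorem image_exponent_le {K L m : ℝ} (hK : 0 < K) (hL : 0 < L) (hm : 1 ≤ m) :
    m * (L ^ 2 / (K + L)) ≤ (L * m) ^ 2 / (K + L * m) := by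
  have hm0 : 0 < m := by linarith
  rw [mul_div_assoc', div_le_div_iff₀ (by positivity) (by positivity)]
  nlinarith [mul_pos hK (mul_pos hL hL), mul_nonneg (sub_nonneg.2 hm) (le_of_lt (mul_pos hm0
    (mul_pos (mul_pos hL hL) hK)))]

/-- Pointwise bound of the deck images: for `1 ≤ L`, `1 ≤ t ≤ L²` and every `n`,
`𝟙[n ≠ 0] Γ_c(t, L•n) ≤ (1+t)⁻² e^{−(c/2)L²/(t+L)} e^{c/3} exp(−(c/12) Σ_μ |n_μ|)`. -/
theorem image_term_le {c : ℝ} (hc : 0 < c) {L : ℕ} (hL : 1 ≤ L) {t : ℝ} (ht : 1 ≤ t)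
    (htL : t ≤ (L : ℝ) ^ 2) (n : Site 4) :
    (if n = 0 then 0 else gaussProfile c t (fun μ => (L : ℤ) * n μ)) ≤
      ((1 + t) ^ 2)⁻¹ * Real.exp (-(c / 2 * (L : ℝ) ^ 2 / (t + (L : ℝ)))) * Real.exp (c / 3) *
        Real.exp (-(c / 12 * ∑ μ : Fin 4, |((n μ : ℤ) : ℝ)|)) := by
  split_ifs with hn
  · positivity
  have hm : 1 ≤ elen n := one_le_elen hn
  have hLr : (1 : ℝ) ≤ L := by exact_mod_cast hL
  have hL0 : (0 : ℝ) < L := by linarith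
  have hK : (0 : ℝ) < 1 + t := by linarith
  unfold gaussProfile
  rw [elen_natMul, mul_assoc, mul_assoc, ← Real.exp_add, ← Real.exp_add]
  gcongr
  have h1 : elen n * ((L : ℝ) ^ 2 / (1 + t + L)) ≤ ((L : ℝ) * elen n) ^ 2 / (1 + t + L * elen n) :=
    image_exponent_le hK hL0 hm
  have h2 : (L : ℝ) ^ 2 / (2 * (t + L)) ≤ (L : ℝ) ^ 2 / (1 + t + L) :=
    div_le_div_of_nonneg_left (sq_nonneg _) (by positivity) (by linarith)
  have h3 : (1 : ℝ) / 3 ≤ (L : ℝ) ^ 2 / (1 + t + L) := by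
    rw [div_le_div_iff₀ (by norm_num) (by positivity)]
    nlinarith
  have h4 := sum_abs_le_four_mul_elen n
  have h5 : (L : ℝ) ^ 2 / (2 * (t + L)) + (elen n - 1) / 3 ≤ elen n * ((L : ℝ) ^ 2 / (1 + t + L)) := by
    have e : elen n * ((L : ℝ) ^ 2 / (1 + t + L)) =
        (L : ℝ) ^ 2 / (1 + t + L) + (elen n - 1) * ((L : ℝ) ^ 2 / (1 + t + L)) := by ring
    rw [e]
    have : (elen n - 1) * (1 / 3 : ℝ) ≤ (elen n - 1) * ((L : ℝ) ^ 2 / (1 + t + L)) :=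
      mul_le_mul_of_nonneg_left h3 (by linarith)
    linarith
  have e1 : c * ((L : ℝ) * elen n) ^ 2 / (1 + t + L * elen n) =
      c * (((L : ℝ) * elen n) ^ 2 / (1 + t + L * elen n)) := by ring
  have e2 : c / 2 * (L : ℝ) ^ 2 / (t + L) = c * ((L : ℝ) ^ 2 / (2 * (t + L))) := by
    field_simp
  rw [e1, e2]
  nlinarith [mul_le_mul_of_nonneg_left (h5.trans h1) hc.le]

/-- Conjunct (6), quantitative: for `1 ≤ L` and `1 ≤ t ≤ L²` the deck images `n ↦ Γ_c(t, L•n)` are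
summable and `Σ_{n ≠ 0} Γ_c(t, L•n) ≤ e^{c/3} (2 + 24/c)⁴ · e^{−(c/2)L²/(t+L)} / t²`. -/
theorem image_sum_bound {c : ℝ} (hc : 0 < c) {L : ℕ} (hL : 1 ≤ L) {t : ℝ} (ht : 1 ≤ t)
    (htL : t ≤ (L : ℝ) ^ 2) :
    Summable (fun n : Site 4 => gaussProfile c t (fun μ => (L : ℤ) * n μ)) ∧
      ∑' n : Site 4, (if n = 0 then 0 else gaussProfile c t (fun μ => (L : ℤ) * n μ)) ≤
        (Real.exp (c / 3) * (2 + 24 / c) ^ 4) *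
          Real.exp (-(c / 2 * (L : ℝ) ^ 2 / (t + (L : ℝ)))) / t ^ 2 := by
  have ht0 : (0 : ℝ) ≤ t := by linarith
  have hLr : (1 : ℝ) ≤ L := by exact_mod_cast hL
  constructor
  · obtain ⟨hs, -⟩ := mass_bound hc ht0
    refine Summable.of_nonneg_of_le (fun n => gaussProfile_nonneg _ _ _) (fun n => ?_) hs
    unfold gaussProfile
    rw [elen_natMul]
    have hr := elen_nonneg n
    have hle : elen n ≤ (L : ℝ) * elen n := le_mul_of_one_le_left hr hLr
    have hK : (0 : ℝ) < 1 + t := by linarith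
    have hmono := sq_div_add_mono hK hr hle
    apply mul_le_mul_of_nonneg_left _ (by positivity)
    apply Real.exp_le_exp.2
    have e1 : c * ((L : ℝ) * elen n) ^ 2 / (1 + t + L * elen n) =
        c * (((L : ℝ) * elen n) ^ 2 / (1 + t + L * elen n)) := by ring
    have e2 : c * elen n ^ 2 / (1 + t + elen n) = c * (elen n ^ 2 / (1 + t + elen n)) := by ring
    rw [e1, e2]
    nlinarith [mul_le_mul_of_nonneg_left hmono hc.le]
  · have hβ : (0 : ℝ) < c / 12 := by positivity
    have hC : 0 ≤ ((1 + t) ^ 2)⁻¹ * Real.exp (-(c / 2 * (L : ℝ) ^ 2 / (t + (L : ℝ)))) *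
        Real.exp (c / 3) := by positivity
    obtain ⟨-, hle⟩ := summable_site_of_le_exp_sum_abs hβ hC
      (fun n => by split_ifs; exacts [le_rfl, gaussProfile_nonneg _ _ _])
      (fun n => image_term_le hc hL ht htL n)
    refine hle.trans ?_
    have e1 : (2 : ℝ) + 2 / (c / 12) = 2 + 24 / c := by field_simp; ring
    rw [e1]
    have hKt : ((1 + t) ^ 2)⁻¹ ≤ 1 / t ^ 2 := by
      rw [inv_eq_one_div]
      gcongr
      linarith
    calc ((1 + t) ^ 2)⁻¹ * Real.exp (-(c / 2 * (L : ℝ) ^ 2 / (t + (L : ℝ)))) * Real.exp (c / 3) *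
          (2 + 24 / c) ^ 4
        ≤ (1 / t ^ 2) * Real.exp (-(c / 2 * (L : ℝ) ^ 2 / (t + (L : ℝ)))) * Real.exp (c / 3) *
          (2 + 24 / c) ^ 4 := by gcongr
      _ = _ := by ring

/-- Registered headline of this helper file (aux stub of `stub_freeMajorantToolkit`): conjuncts
(3) moments, (4) shifts, (5) mass and (6) image sum of the free majorant toolkit. -/
theorem stub_freeMajorantToolkitAuxB : (∀ c ε : ℝ, 0 < c → 0 < ε → ε < 1 → ∀ j : ℕ, ∃ A : ℝ, ∀ t : ℝ, 0 ≤ t → ∀ w : Site 4, elen w ^ j * gaussProfile c t w ≤ A * Real.sqrt (1 + t) ^ j * gaussProfile ((1 - ε) * c) t w) ∧ (∀ c ε : ℝ, 0 < c → 0 < ε → ε < 1 → ∃ A : ℝ, ∀ t : ℝ, 0 ≤ t → ∀ w z : Site 4, elen z ≤ 2 → gaussProfile c t (w + z) ≤ A * gaussProfile ((1 - ε) * c) t w) ∧ (∀ c : ℝ, 0 < c → ∃ A : ℝ, ∀ t : ℝ, 0 ≤ t → Summable (fun y : Site 4 => gaussProfile c t y) ∧ ∑' y : Site 4, gaussProfile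 c t y ≤ A) ∧ (∀ c : ℝ, 0 < c → ∃ C : ℝ, ∀ (L : ℕ), 1 ≤ L → ∀ t : ℝ, 1 ≤ t → t ≤ (L : ℝ) ^ 2 → Summable (fun n : Site 4 => gaussProfile c t (fun μ => (L : ℤ) * n μ)) ∧ ∑' n : Site 4, (if n = 0 then 0 else gaussProfile c t (fun μ => (L : ℤ) * n μ)) ≤ C * Real.exp (-(c / 2 * (L : ℝ) ^ 2 / (t + (L : ℝ)))) / t ^ 2) :=
  ⟨fun _c _ε hc hε _ j => ⟨_, fun _t ht w => moment_bound hc hε j ht w⟩,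
    fun _c _ε hc hε _ => ⟨_, fun _t ht w z hz => shift_bound hc hε.le ht w z hz⟩,
    fun _c hc => ⟨_, fun _t ht => mass_bound hc ht⟩,
    fun _c hc => ⟨_, fun _L hL _t ht htL => image_sum_bound hc hL ht htL⟩⟩

end Summit.QuantumFields.QCD.Cruxes.QuarkLoopCoefficient.Sketch.FreeMajorantToolkit
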